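import Literature.NumberTheory.Sieve.FriedlanderIwaniecPrimesJacobiTwistedForms
import HarnessLib

/-!
# Friedlander–Iwaniec, *The polynomial `X² + Y⁴` captures its primes*, §12: the range (12.12) of the
# complementary divisor

[FI, §12, p. 51 of arXiv:math/9811185 = Ann. of Math. (2) 148 (1998), 945–1040]: after the flip
(12.10)–(12.11), "we observe that `q` runs over the segment (12.12) `RS/(cDH) < q < 24RS/(cD)`, which
fact follows by examining the support of `g`", and `f(dm) = f(|s₁/r₁ − s₂/r₂| r₁r₂/q)`.

This file PROVES that bookkeeping (`sum_moduli_eq_sum_range`), as the exact identity gluing the output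
of the flip (`sum_dvd_mul_eq_sum_complementary`, `…JacobiTwistedFlipReduction`: weight
`f(|Δ|/q) = F((|Δ|/q)/D)` with `|Δ| = |t₁s₂ − t₂s₁|` an integer divided exactly by `q`) to the input of
the kernel insertion (`norm_sum_mul_kernel_le`, `…JacobiTwistedKernelInsertion`: weight
`F(|x|·(ct₁t₂/q)/D) g(|x|)`, `x = s₁/(ct₁) − s₂/(ct₂)`): under `qm ∣ Δ` the two weights agree
(`|x| c t₁ t₂ = |Δ|`), and since `F` vanishes off `(1/2, 5/2)` and `g` off `(a, 3b)`, only the moduli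
`2aR²/(5cD) < q < 24bR²/(cD)` contribute (FI: `a = S/(HR)`, `b = S/R`, giving (12.12) up to the
harmless constants `2/5` and `24`).  No definitions, no named facts
(HOME/parity-ideate-lit/FI98-Prop121-MAP.md, step D0 of the g26 addendum).

## References

* J. Friedlander, H. Iwaniec, *The polynomial `X² + Y⁴` captures its primes*, Ann. of Math. (2) 148
  (1998), 945–1040, §12, (12.10)–(12.12). [FriedlanderIwaniecAnnals1998]
-/

noncomputable section

open Finset Real Complex
open scoped NumberTheorySymbols ComplexConjugate

namespace Literature.NumberTheory.Sieve.FriedlanderIwaniecPrimes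

/-- Under `qm ∣ Δ = t₁s₂ − t₂s₁`: `(|Δ|/q : ℕ) = |s₁/(ct₁) − s₂/(ct₂)| · ct₁t₂/q` as reals
("`f(dm) = f(|s₁/r₁ − s₂/r₂| r₁r₂/q)`"). [cite: FriedlanderIwaniecAnnals1998, §12, before (12.10)] -/
theorem natAbs_det_div_eq {t₁ s₁ t₂ s₂ q m c : ℕ} (hc : 0 < c) (ht₁ : 0 < t₁) (ht₂ : 0 < t₂)
    (hq : 0 < q) (hdvd : ((q * m : ℕ) : ℤ) ∣ (t₁ : ℤ) * s₂ - (t₂ : ℤ) * s₁) :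
    (((((t₁ : ℤ) * s₂ - (t₂ : ℤ) * s₁).natAbs / q : ℕ)) : ℝ) =
      |(s₁ : ℝ) / (c * t₁) - (s₂ : ℝ) / (c * t₂)| * ((c : ℝ) * t₁ * t₂ / q) := by
  have hqd : q ∣ ((t₁ : ℤ) * s₂ - (t₂ : ℤ) * s₁).natAbs :=
    (Dvd.intro m rfl).trans (Int.natCast_dvd.mp hdvd)
  have hq0 : (q : ℝ) ≠ 0 := by exact_mod_cast hq.ne'
  rw [Nat.cast_div hqd hq0, Nat.cast_natAbs, Int.cast_abs]
  push_cast
  have hc0 : (0 : ℝ) < c := by exact_mod_cast hc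
  have ht₁0 : (0 : ℝ) < t₁ := by exact_mod_cast ht₁
  have ht₂0 : (0 : ℝ) < t₂ := by exact_mod_cast ht₂
  have e : (s₁ : ℝ) / (c * t₁) - (s₂ : ℝ) / (c * t₂) =
      -(((t₁ : ℝ) * s₂ - (t₂ : ℝ) * s₁) / ((c : ℝ) * t₁ * t₂)) := by
    field_simp
    ring
  rw [e, abs_neg, abs_div, abs_of_pos (by positivity : (0 : ℝ) < (c : ℝ) * t₁ * t₂)]
  field_simp

/-- A reduced box variable `t ∈ (R/c, 2R/c]` (integer division) satisfies `R/c < t ≤ 2R/c` in `ℝ`.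
[folklore] -/
private theorem mem_Ioc_div_real {R c t : ℕ} (hc : 0 < c) (ht : t ∈ Ioc (R / c) (2 * R / c)) :
    (R : ℝ) / c < t ∧ (t : ℝ) ≤ 2 * (R : ℝ) / c := by
  obtain ⟨h1, h2⟩ := mem_Ioc.mp ht
  have hc0 : (0 : ℝ) < c := by exact_mod_cast hc
  constructor
  · rw [div_lt_iff₀ hc0]
    have h3 : R < R / c * c + c := Nat.lt_div_mul_add hc
    have h4 : (R / c + 1) * c ≤ t * c := Nat.mul_le_mul_right c h1
    have h5 : R < t * c := by
      have : R / c * c + c = (R / c + 1) * c := by ring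
      omega
    exact_mod_cast h5
  · calc (t : ℝ) ≤ ((2 * R / c : ℕ) : ℝ) := by exact_mod_cast h2
      _ ≤ (2 * R : ℕ) / (c : ℝ) := Nat.cast_div_le
      _ = 2 * (R : ℝ) / c := by push_cast; ring

/-- **The range (12.12)** [FI, §12]: for `t₁, t₂` in the reduced box `(R/c, 2R/c]`, `R ≥ 1`, a modulus
`q ≥ 1`, `F` vanishing off `(1/2, 5/2)` and `g` vanishing off `(a, 3b)` (`a > 0`): if
`F(|x|·(ct₁t₂/q)/D) g(|x|) ≠ 0` then `2aR²/(5cD) < q < 24bR²/(cD)` ("`q` runs over the segment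
`RS/(cDH) < q < 24RS/(cD)`, which fact follows by examining the support of `g`"; FI: `a = S/(HR)`,
`b = S/R`). [cite: FriedlanderIwaniecAnnals1998, §12, (12.12)] -/
theorem modulus_mem_range_of_ne_zero {R c D t₁ t₂ q : ℕ} (hR : 1 ≤ R) (hc : 0 < c) (hD : 0 < D)
    (hq : 0 < q) (ht₁ : t₁ ∈ Ioc (R / c) (2 * R / c)) (ht₂ : t₂ ∈ Ioc (R / c) (2 * R / c))
    (F : ℝ → ℝ) (hF3 : ∀ w, w ≤ 1 / 2 → F w = 0) (hF4 : ∀ w, 5 / 2 ≤ w → F w = 0)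
    (g : ℝ → ℝ) {a b : ℝ} (ha : 0 < a) (hga : ∀ x, x ≤ a → g x = 0) (hgb : ∀ x, 3 * b ≤ x → g x = 0)
    {x : ℝ} (hne : F (|x| * ((c : ℝ) * t₁ * t₂ / q) / D) * g |x| ≠ 0) :
    2 * a * (R : ℝ) ^ 2 / (5 * c * D) < q ∧ (q : ℝ) < 24 * b * (R : ℝ) ^ 2 / (c * D) := by
  have hc0 : (0 : ℝ) < c := by exact_mod_cast hc
  have hD0 : (0 : ℝ) < D := by exact_mod_cast hD
  have hq0 : (0 : ℝ) < q := by exact_mod_cast hq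
  have hR0 : (0 : ℝ) < R := by exact_mod_cast hR
  obtain ⟨ht₁l, ht₁u⟩ := mem_Ioc_div_real hc ht₁
  obtain ⟨ht₂l, ht₂u⟩ := mem_Ioc_div_real hc ht₂
  have hRc : 0 ≤ (R : ℝ) / c := by positivity
  have ht₁0 : (0 : ℝ) < t₁ := hRc.trans_lt ht₁l
  have ht₂0 : (0 : ℝ) < t₂ := hRc.trans_lt ht₂l
  -- the supports
  have hg : g |x| ≠ 0 := fun h => hne (by rw [h, mul_zero])
  have hF : F (|x| * ((c : ℝ) * t₁ * t₂ / q) / D) ≠ 0 := fun h => hne (by rw [h, zero_mul])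
  have hxa : a < |x| := by
    by_contra h; exact hg (hga _ (not_lt.mp h))
  have hxb : |x| < 3 * b := by
    by_contra h; exact hg (hgb _ (not_lt.mp h))
  have hw1 : 1 / 2 < |x| * ((c : ℝ) * t₁ * t₂ / q) / D := by
    by_contra h; exact hF (hF3 _ (not_lt.mp h))
  have hw2 : |x| * ((c : ℝ) * t₁ * t₂ / q) / D < 5 / 2 := by
    by_contra h; exact hF (hF4 _ (not_lt.mp h))
  -- the size of `c t₁ t₂`
  have hPl : (R : ℝ) ^ 2 / c < (c : ℝ) * t₁ * t₂ := by
    have h1 : (R : ℝ) / c * ((R : ℝ) / c) < (t₁ : ℝ) * t₂ :=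
      mul_lt_mul'' ht₁l ht₂l hRc hRc
    have e : (R : ℝ) ^ 2 / c = c * ((R : ℝ) / c * ((R : ℝ) / c)) := by field_simp
    rw [e, mul_assoc]
    exact mul_lt_mul_of_pos_left h1 hc0
  have hPu : (c : ℝ) * t₁ * t₂ ≤ 4 * (R : ℝ) ^ 2 / c := by
    have h1 : (t₁ : ℝ) * t₂ ≤ 2 * (R : ℝ) / c * (2 * (R : ℝ) / c) :=
      mul_le_mul ht₁u ht₂u ht₂0.le (by positivity)
    have e : 4 * (R : ℝ) ^ 2 / c = c * (2 * (R : ℝ) / c * (2 * (R : ℝ) / c)) := by field_simp; ring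
    rw [e, mul_assoc]
    exact mul_le_mul_of_nonneg_left h1 hc0.le
  have hP0 : (0 : ℝ) < (c : ℝ) * t₁ * t₂ := by positivity
  constructor
  · -- `q ≤ Q₁` would force `w > 5/2`
    by_contra hle
    have hle' : (q : ℝ) ≤ 2 * a * (R : ℝ) ^ 2 / (5 * c * D) := not_lt.mp hle
    have h1 : a * ((R : ℝ) ^ 2 / c) < |x| * ((c : ℝ) * t₁ * t₂) :=
      mul_lt_mul'' hxa hPl ha.le (by positivity)
    -- `w = |x| c t₁ t₂ / (q D) ≥ |x| c t₁ t₂ / (Q₁ D) > a (R²/c) / (Q₁ D) = 5/2`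
    have h2 : |x| * ((c : ℝ) * t₁ * t₂ / q) / D = |x| * ((c : ℝ) * t₁ * t₂) / (q * D) := by
      field_simp
    rw [h2] at hw2
    have h3 : a * ((R : ℝ) ^ 2 / c) / (q * D) < 5 / 2 := by
      refine lt_of_le_of_lt ?_ hw2
      exact div_le_div_of_nonneg_right h1.le (by positivity)
    have h4 : (5 : ℝ) / 2 ≤ a * ((R : ℝ) ^ 2 / c) / (q * D) := by
      rw [le_div_iff₀ (by positivity)]
      have h5 : (q : ℝ) * D ≤ 2 * a * (R : ℝ) ^ 2 / (5 * c * D) * D :=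
        mul_le_mul_of_nonneg_right hle' hD0.le
      have e : 2 * a * (R : ℝ) ^ 2 / (5 * c * D) * D = (2 / 5) * (a * ((R : ℝ) ^ 2 / c)) := by
        field_simp
      rw [e] at h5
      nlinarith [h5, ha, hR0, hc0]
    linarith
  · -- `q ≥ Q₂` would force `w < 1/2`
    by_contra hle
    have hle' : 24 * b * (R : ℝ) ^ 2 / (c * D) ≤ q := not_lt.mp hle
    have hb : 0 < b := by linarith [abs_nonneg x]
    have h1 : |x| * ((c : ℝ) * t₁ * t₂) < 3 * b * (4 * (R : ℝ) ^ 2 / c) := by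
      calc |x| * ((c : ℝ) * t₁ * t₂) ≤ |x| * (4 * (R : ℝ) ^ 2 / c) :=
            mul_le_mul_of_nonneg_left hPu (abs_nonneg x)
        _ < 3 * b * (4 * (R : ℝ) ^ 2 / c) := mul_lt_mul_of_pos_right hxb (by positivity)
    have h2 : |x| * ((c : ℝ) * t₁ * t₂ / q) / D = |x| * ((c : ℝ) * t₁ * t₂) / (q * D) := by
      field_simp
    rw [h2] at hw1
    have hQD : 0 < (q : ℝ) * D := by positivity
    have h3 : 1 / 2 < 3 * b * (4 * (R : ℝ) ^ 2 / c) / (q * D) :=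
      hw1.trans (div_lt_div_of_pos_right h1 hQD)
    have h4 : 3 * b * (4 * (R : ℝ) ^ 2 / c) / (q * D) ≤ 1 / 2 := by
      rw [div_le_iff₀ hQD]
      have h5 : 24 * b * (R : ℝ) ^ 2 / (c * D) * D ≤ (q : ℝ) * D :=
        mul_le_mul_of_nonneg_right hle' hD0.le
      have e : 24 * b * (R : ℝ) ^ 2 / (c * D) * D = 2 * (3 * b * (4 * (R : ℝ) ^ 2 / c)) := by
        field_simp
        ring
      rw [e] at h5
      linarith
    linarith

/-- **From the flipped weight to the kernel weight, on the range (12.12)** [FI, §12]: for `c, D, R ≥ 1`,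
any `m, L`, coefficients `β`, `F` vanishing off `(1/2, 5/2)`, `g` vanishing off `(a, 3b)` (`a > 0`),
`∑_{q ≤ L} ∑∑_{qm ∣ Δ, (t₁,t₂)=1} β₁β̄₂ (q/(t₁t₂)) F((|Δ|/q)/D) g(|x|)
   = ∑_{q ≤ L, 2aR²/(5cD) < q < 24bR²/(cD)} ∑∑_{qm ∣ Δ, (t₁,t₂)=1} β₁β̄₂ (q/(t₁t₂)) F(|x|·(ct₁t₂/q)/D) g(|x|)`,
`Δ = t₁s₂ − t₂s₁`, `x = s₁/(ct₁) − s₂/(ct₂)`, over the reduced boxes `R/c < tᵢ ≤ 2R/c`, `S < sᵢ ≤ 2S`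
(the output of `sum_dvd_mul_eq_sum_complementary` with `w(d) = F(d/D)`, `G = g(|x|)`, rewritten as the
input of `norm_sum_mul_kernel_le`). [cite: FriedlanderIwaniecAnnals1998, §12, (12.10)–(12.12)] -/
theorem sum_moduli_eq_sum_range {R S c m D L : ℕ} (hR : 1 ≤ R) (hc : 0 < c) (hD : 0 < D)
    (F : ℝ → ℝ) (hF3 : ∀ w, w ≤ 1 / 2 → F w = 0) (hF4 : ∀ w, 5 / 2 ≤ w → F w = 0)
    (g : ℝ → ℝ) {a b : ℝ} (ha : 0 < a) (hga : ∀ x, x ≤ a → g x = 0) (hgb : ∀ x, 3 * b ≤ x → g x = 0)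
    (β : ℕ → ℕ → ℂ) :
    ∑ q ∈ Ioc 0 L, ∑ t₁ ∈ Ioc (R / c) (2 * R / c), ∑ s₁ ∈ Ioc S (2 * S), ∑ t₂ ∈ Ioc (R / c) (2 * R / c),
        ∑ s₂ ∈ Ioc S (2 * S),
        (if ((q * m : ℕ) : ℤ) ∣ (t₁ : ℤ) * s₂ - (t₂ : ℤ) * s₁ ∧ t₁.Coprime t₂ then
          β t₁ s₁ * conj (β t₂ s₂) * (J((q : ℤ) | t₁ * t₂) : ℂ) *
            ((F (((((t₁ : ℤ) * s₂ - (t₂ : ℤ) * s₁).natAbs / q : ℕ) : ℝ) / D) : ℂ) *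
              (g |(s₁ : ℝ) / (c * t₁) - (s₂ : ℝ) / (c * t₂)| : ℂ)) else 0) =
      ∑ q ∈ (Ioc 0 L).filter (fun q : ℕ =>
          2 * a * (R : ℝ) ^ 2 / (5 * c * D) < q ∧ (q : ℝ) < 24 * b * (R : ℝ) ^ 2 / (c * D)),
        ∑ t₁ ∈ Ioc (R / c) (2 * R / c), ∑ s₁ ∈ Ioc S (2 * S), ∑ t₂ ∈ Ioc (R / c) (2 * R / c),
        ∑ s₂ ∈ Ioc S (2 * S),
        (if ((q * m : ℕ) : ℤ) ∣ (t₁ : ℤ) * s₂ - (t₂ : ℤ) * s₁ ∧ t₁.Coprime t₂ then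
          β t₁ s₁ * conj (β t₂ s₂) * (J((q : ℤ) | t₁ * t₂) : ℂ) *
            ((F (|(s₁ : ℝ) / (c * t₁) - (s₂ : ℝ) / (c * t₂)| * ((c : ℝ) * t₁ * t₂ / q) / D) *
              g |(s₁ : ℝ) / (c * t₁) - (s₂ : ℝ) / (c * t₂)| : ℝ) : ℂ) else 0) := by
  rw [sum_filter]
  refine sum_congr rfl fun q hq => ?_
  have hq0 : 0 < q := (mem_Ioc.mp hq).1
  -- termwise: the two weights agree under the divisibility condition
  have hterm : ∀ t₁ ∈ Ioc (R / c) (2 * R / c), ∀ s₁ ∈ Ioc S (2 * S), ∀ t₂ ∈ Ioc (R / c) (2 * R / c),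
      ∀ s₂ ∈ Ioc S (2 * S),
      (if ((q * m : ℕ) : ℤ) ∣ (t₁ : ℤ) * s₂ - (t₂ : ℤ) * s₁ ∧ t₁.Coprime t₂ then
          β t₁ s₁ * conj (β t₂ s₂) * (J((q : ℤ) | t₁ * t₂) : ℂ) *
            ((F (((((t₁ : ℤ) * s₂ - (t₂ : ℤ) * s₁).natAbs / q : ℕ) : ℝ) / D) : ℂ) *
              (g |(s₁ : ℝ) / (c * t₁) - (s₂ : ℝ) / (c * t₂)| : ℂ)) else 0) =
      (if ((q * m : ℕ) : ℤ) ∣ (t₁ : ℤ) * s₂ - (t₂ : ℤ) * s₁ ∧ t₁.Coprime t₂ then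
          β t₁ s₁ * conj (β t₂ s₂) * (J((q : ℤ) | t₁ * t₂) : ℂ) *
            ((F (|(s₁ : ℝ) / (c * t₁) - (s₂ : ℝ) / (c * t₂)| * ((c : ℝ) * t₁ * t₂ / q) / D) *
              g |(s₁ : ℝ) / (c * t₁) - (s₂ : ℝ) / (c * t₂)| : ℝ) : ℂ) else 0) := by
    intro t₁ ht₁ s₁ _ t₂ ht₂ s₂ _
    split_ifs with h
    · have ht₁0 : 0 < t₁ := lt_of_le_of_lt (Nat.zero_le _) (mem_Ioc.mp ht₁).1
      have ht₂0 : 0 < t₂ := lt_of_le_of_lt (Nat.zero_le _) (mem_Ioc.mp ht₂).1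
      rw [natAbs_det_div_eq hc ht₁0 ht₂0 hq0 h.1]
      push_cast
      ring
    · rfl
  by_cases hrange : 2 * a * (R : ℝ) ^ 2 / (5 * c * D) < q ∧ (q : ℝ) < 24 * b * (R : ℝ) ^ 2 / (c * D)
  · rw [if_pos hrange]
    exact sum_congr rfl fun t₁ ht₁ => sum_congr rfl fun s₁ hs₁ => sum_congr rfl fun t₂ ht₂ =>
      sum_congr rfl fun s₂ hs₂ => hterm t₁ ht₁ s₁ hs₁ t₂ ht₂ s₂ hs₂
  · rw [if_neg hrange]
    refine sum_eq_zero fun t₁ ht₁ => sum_eq_zero fun s₁ hs₁ => sum_eq_zero fun t₂ ht₂ =>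
      sum_eq_zero fun s₂ hs₂ => ?_
    rw [hterm t₁ ht₁ s₁ hs₁ t₂ ht₂ s₂ hs₂]
    split_ifs with h
    · have hz : F (|(s₁ : ℝ) / (c * t₁) - (s₂ : ℝ) / (c * t₂)| * ((c : ℝ) * t₁ * t₂ / q) / D) *
          g |(s₁ : ℝ) / (c * t₁) - (s₂ : ℝ) / (c * t₂)| = 0 := by
        by_contra hne
        exact hrange (modulus_mem_range_of_ne_zero hR hc hD hq0 ht₁ ht₂ F hF3 hF4 g ha hga hgb hne)
      rw [hz, Complex.ofReal_zero, mul_zero]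
    · rfl

end Literature.NumberTheory.Sieve.FriedlanderIwaniecPrimes
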